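import Mathlib
import Literature.NumberTheory.Transcendental.PiAlgebraicApproximationMeasure
import HarnessLib

/-!
# Transcendence measure for `π` (Nesterenko–Waldschmidt 1996, Theorem 2) — the parameters

Sibling PROOFS file of `PiTranscendenceMeasure.lean` (the named fact
`Literature.NumberTheory.Transcendental.NesterenkoWaldschmidt1996_thm_2_2`). Everything here is
PROVED; no definitions, no named facts; elementary real inequalities only.

This is the choice of parameters of [NesterenkoWaldschmidt1996, §6] for the Main Theorem at
`θ = πi`, `α = -1`, `β` algebraic of degree `D` with `log M(β) ≤ D h_B`, and the numerical
verification replacing (6.4)–(6.11) there. We take `E = e²` (`log E = 2`) and, in the notation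
`U log E = u`, `V log E = v`, `W log E = w` of the paper,

  `u = 3.3 D log(D+2) + 2`,  `v = 2e²π + 2` (`∈ [48.4, 48.44]`),  `w = h_B + 4 log D + 13.3`,
  `T₁ = ⌊2.1u + ½⌋ = ⌊4.2U + ½⌋`, `S₁ = ⌊6Dw + ½⌋ = ⌊12DW + ½⌋`, `H = ⌊1.5w⌋ = ⌊1.5 W log E⌋`,
  `S = ⌊2.625uv⌋ = ⌊10.5UV⌋`, `T = ⌊5Dvw⌋ = ⌊20DVW⌋`, `L = (T+1)(2T₁+1)`.

Compared with the printed choice (`V log E = D log A + 2E|θ| + 6 log E`,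
`W log E = log B + log log A + 4 log D + 2 log(E|θ|₊) + 10`, `T = ⌊20.2 DVW⌋`) the constants in
`v` and `w` use the slack available for `θ = πi` (only `2E|θ| + 2 ≤ V log E`, `V ≥ 6` and (6.10)
are needed), which pays for the prime number bound `log ν(H) ≤ 1.15 H` available in the tree
(instead of `(107/103) H`) and for Liouville's inequality with exponent `D` in place of `D − 1`
nowhere: the budget per row of the determinant is `0.7 + 19.03 Φ < 21 Φ − 1 < L − 1`,
`Φ = D u v w ≥ 3411` (`NWPi.perL_le`, `NWPi.params_main`), against `84.83 < 84.84` in print.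

`NWPi.params_basic`, `NWPi.params_counts`, `NWPi.params_L`, `NWPi.params_main` prove: the floor
bounds; `H, T₁, S₁, S ≥ 1`, `2T₁ ≤ S + 1` and the zero-estimate count `(2T₁+1)T < (S+1-2T₁)(2S₁+1)`
(condition (2.1)); `21 Φ < L ≤ 23 Φ` and the smallness exponent `log S + S log 4.2 + 2L ≤ 47 Φ`;
and the main inequality of `NWPi.pi_core` (`PiTranscendenceMeasureCore.lean`) with `E = e²`,
`lν = 1.15 H`, `H_β = D h_B`, `Dr = D`. `NWPi.Tgroup_ineq` is the comparison
`D(4.5 + log D) ≤ 1.1 u(D)` (cases `D ≤ 3` numerically, `log 6 ≥ 1.75` beyond).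

## References

* [NesterenkoWaldschmidt1996] Yu. V. Nesterenko, M. Waldschmidt, *On the approximation of the values
  of exponential function and logarithm by algebraic numbers*, Mat. Zapiski 2 (1996) 23–42
  (arXiv:math/0002047), §6 (6.1), (6.4)–(6.11).
-/

noncomputable section

open Real

namespace Literature.NumberTheory.Transcendental

namespace NWPi

/-! ### Numerical constants -/

/-- `2.718 < e < 2.7183`. [folklore] -/
theorem e_bounds' : (2.718 : ℝ) < exp 1 ∧ exp 1 < 2.7183 :=
  ⟨by have := Real.exp_one_gt_d9; linarith, by have := Real.exp_one_lt_d9; linarith⟩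

/-- `exp n ≥ 2.718^n`. [folklore] -/
theorem pow_le_exp_nat (n : ℕ) : (2.718 : ℝ) ^ n ≤ exp n := by
  calc (2.718 : ℝ) ^ n ≤ (exp 1) ^ n := by gcongr; exact e_bounds'.1.le
    _ = exp n := by rw [← Real.exp_nat_mul, mul_one]

/-- `exp n ≤ 2.7183^n`. [folklore] -/
theorem exp_nat_le_pow (n : ℕ) : exp n ≤ (2.7183 : ℝ) ^ n := by
  calc exp (n : ℝ) = (exp 1) ^ n := by rw [← Real.exp_nat_mul, mul_one]
    _ ≤ (2.7183 : ℝ) ^ n := by gcongr; exact e_bounds'.2.le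

/-- `7.389 < e² < 7.3891`. [folklore] -/
theorem exp_two_bounds : (7.389 : ℝ) < exp 2 ∧ exp 2 < 7.3891 := by
  have h : exp 2 = exp 1 ^ 2 := by rw [← Real.exp_nat_mul]; norm_num
  have h1 := Real.exp_one_gt_d9
  have h2 := Real.exp_one_lt_d9
  constructor
  · rw [h]; nlinarith
  · rw [h]; nlinarith

/-- `log x ≤ c` as soon as `x ≤ 2.718^c` (`c ∈ ℕ`). [folklore] -/
theorem log_le_nat_of_le_pow {x : ℝ} (hx : 0 < x) (c : ℕ) (h : x ≤ (2.718 : ℝ) ^ c) :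
    log x ≤ c := by
  rw [Real.log_le_iff_le_exp hx]
  exact h.trans (pow_le_exp_nat c)

/-- `log x ≤ c/2` as soon as `x² ≤ 2.718^c`. [folklore] -/
theorem log_le_half_nat_of_sq_le_pow {x : ℝ} (hx : 0 < x) (c : ℕ) (h : x ^ 2 ≤ (2.718 : ℝ) ^ c) :
    log x ≤ c / 2 := by
  have h2 : 2 * log x ≤ c := by
    have e : log (x ^ 2) = 2 * log x := by rw [Real.log_pow]; norm_num
    rw [← e, Real.log_le_iff_le_exp (by positivity)]
    exact h.trans (pow_le_exp_nat c)
  linarith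

/-- `c ≤ log x` as soon as `2.7183^c ≤ x`. [folklore] -/
theorem nat_le_log_of_pow_le {x : ℝ} (c : ℕ) (h : (2.7183 : ℝ) ^ c ≤ x) : (c : ℝ) ≤ log x := by
  have hx : 0 < x := lt_of_lt_of_le (by positivity) h
  rw [Real.le_log_iff_exp_le hx]
  exact (exp_nat_le_pow c).trans h

/-- `c/n ≤ log x` as soon as `2.7183^c ≤ x^n` (`n ≥ 1`). [folklore] -/
theorem div_le_log_of_pow_le {x : ℝ} (c n : ℕ) (hn : 0 < n)
    (h : (2.7183 : ℝ) ^ c ≤ x ^ n) : (c : ℝ) / n ≤ log x := by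
  have h1 : (c : ℝ) ≤ n * log x := by
    rw [← Real.log_pow]
    exact nat_le_log_of_pow_le c h
  have hn' : (0 : ℝ) < n := by exact_mod_cast hn
  rw [div_le_iff₀ hn']
  linarith

/-- `1 ≤ log 3`. [folklore] -/
theorem one_le_log_three : (1 : ℝ) ≤ log 3 := by
  have := nat_le_log_of_pow_le (x := 3) 1 (by norm_num)
  simpa using this

/-- `log 2 < 0.6932`, `0.6931 < log 2`. [folklore] -/
theorem log_two_bounds : (0.6931 : ℝ) < log 2 ∧ log 2 < 0.6932 :=
  ⟨by have := Real.log_two_gt_d9; linarith, by have := Real.log_two_lt_d9; linarith⟩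

/-- `1.6 ≤ log 5`. [folklore] -/
theorem log_five_ge : (1.6 : ℝ) ≤ log 5 := by
  have := div_le_log_of_pow_le (x := 5) 8 5 (by norm_num) (by norm_num)
  norm_num at this
  linarith

/-- `1.75 ≤ log 6`. [folklore] -/
theorem log_six_ge : (1.75 : ℝ) ≤ log 6 := by
  have := div_le_log_of_pow_le (x := 6) 7 4 (by norm_num) (by norm_num)
  norm_num at this
  linarith

/-- `log π ≤ 1.3` (indeed `π < 3.15 < 2.718 · 1.3 ≤ e · e^{0.3}`). [folklore] -/
theorem log_pi_le : log Real.pi ≤ 1.3 := by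
  rw [Real.log_le_iff_le_exp Real.pi_pos]
  have h1 : exp (1.3 : ℝ) = exp 1 * exp 0.3 := by rw [← Real.exp_add]; norm_num
  have h2 : (1.3 : ℝ) ≤ exp 0.3 := by have := Real.add_one_le_exp (0.3 : ℝ); linarith
  have h3 := Real.pi_lt_d2
  rw [h1]
  nlinarith [e_bounds'.1, Real.exp_pos (0.3 : ℝ)]

/-- The constant `v = 2e²π + 2 ∈ [48.4, 48.44]` and `πe² ≤ 23.22`. [folklore] -/
theorem v_bounds : (48.4 : ℝ) ≤ 2 * exp 2 * Real.pi + 2 ∧ 2 * exp 2 * Real.pi + 2 ≤ 48.44 ∧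
    Real.pi * exp 2 ≤ 23.22 := by
  obtain ⟨h1, h2⟩ := exp_two_bounds
  have h3 := Real.pi_gt_d2
  have h4 := Real.pi_lt_d4
  refine ⟨by nlinarith, by nlinarith, by nlinarith⟩

/-- `log y ≤ y / 8095 + 8` for `y > 0` (tangent bound at `e⁹ ≥ 8095`). [folklore] -/
theorem log_le_linear' {y : ℝ} (hy : 0 < y) : log y ≤ y / 8095 + 8 := by
  have h9 : (8095 : ℝ) ≤ exp 9 := by
    have := pow_le_exp_nat 9
    norm_num at this
    linarith
  have h1 : log (y / exp 9) ≤ y / exp 9 - 1 := Real.log_le_sub_one_of_pos (by positivity)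
  rw [Real.log_div hy.ne' (Real.exp_pos 9).ne', Real.log_exp] at h1
  have h2 : y / exp 9 ≤ y / 8095 := div_le_div_of_nonneg_left hy.le (by norm_num) h9
  linarith

/-! ### The functions `u(D)`, `w` and the elementary comparisons -/

/-- `u = 3.3 D log(D+2) + 2` satisfies `5.3 ≤ u`, `3.3 D ≤ u`, `u ≤ 8.6 D²`. [folklore] -/
theorem u_bounds (D : ℕ) (hD : 1 ≤ D) {u : ℝ} (hu : u = 33 / 10 * D * log ((D : ℝ) + 2) + 2) :
    5.3 ≤ u ∧ 33 / 10 * (D : ℝ) ≤ u ∧ u ≤ 8.6 * (D : ℝ) ^ 2 := by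
  have hD' : (1 : ℝ) ≤ D := by exact_mod_cast hD
  have hlog3 : 1 ≤ log ((D : ℝ) + 2) :=
    one_le_log_three.trans (Real.log_le_log (by norm_num) (by linarith))
  have hlogle : log ((D : ℝ) + 2) ≤ (D : ℝ) + 1 := by
    have := Real.log_le_sub_one_of_pos (by linarith : (0 : ℝ) < D + 2); linarith
  have h1 : 33 / 10 * (D : ℝ) ≤ 33 / 10 * D * log ((D : ℝ) + 2) := by
    have : 33 / 10 * (D : ℝ) * 1 ≤ 33 / 10 * D * log ((D : ℝ) + 2) :=
      mul_le_mul_of_nonneg_left hlog3 (by positivity)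
    linarith
  refine ⟨?_, ?_, ?_⟩
  · rw [hu]; nlinarith
  · rw [hu]; linarith
  · rw [hu]
    have : 33 / 10 * (D : ℝ) * log ((D : ℝ) + 2) ≤ 33 / 10 * D * ((D : ℝ) + 1) :=
      mul_le_mul_of_nonneg_left hlogle (by positivity)
    nlinarith

/-- **The `T`-group comparison**: `D (4.5 + log D) ≤ 1.1 u(D)` for every integer `D ≥ 1`
(cases `D = 1, 2, 3` numerically; `log(D+2) ≥ log 6 ≥ 1.75` for `D ≥ 4`). [folklore] -/
theorem Tgroup_ineq (D : ℕ) (hD : 1 ≤ D) :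
    (D : ℝ) * (4.5 + log D) ≤ 11 / 10 * (33 / 10 * D * log ((D : ℝ) + 2) + 2) := by
  obtain ⟨hl2, hl2'⟩ := log_two_bounds
  rcases Nat.lt_or_ge D 4 with hlt | hge
  · interval_cases D
    · norm_num
      have := one_le_log_three
      linarith
    · norm_num
      have h4 : log (4 : ℝ) = 2 * log 2 := by
        rw [show (4 : ℝ) = 2 ^ 2 by norm_num, Real.log_pow]; norm_num
      rw [h4]; nlinarith
    · norm_num
      have h3 : log (3 : ℝ) ≤ 2 * log 2 := by
        rw [← Real.log_rpow (by norm_num)]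
        exact Real.log_le_log (by norm_num) (by norm_num)
      have h5 := log_five_ge
      nlinarith
  · have hD' : (4 : ℝ) ≤ D := by exact_mod_cast hge
    have hlogD : log (D : ℝ) ≤ log ((D : ℝ) + 2) := Real.log_le_log (by linarith) (by linarith)
    have hlog6 : 1.75 ≤ log ((D : ℝ) + 2) :=
      log_six_ge.trans (Real.log_le_log (by norm_num) (by linarith))
    have hlogD0 : 0 ≤ log (D : ℝ) := Real.log_nonneg (by linarith)
    nlinarith [mul_le_mul_of_nonneg_left hlogD (by linarith : (0 : ℝ) ≤ D),
      mul_le_mul_of_nonneg_left hlog6 (by linarith : (0 : ℝ) ≤ D)]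

/-- `log S + log T₁ ≤ 10 + 4 log D` when `1 ≤ S ≤ 127.2 u`, `1 ≤ T₁ ≤ 2.195 u`, `u ≤ 8.6 D²`. [folklore] -/
theorem log_S_add_log_T₁_le {S T₁ u D : ℝ} (hD : 1 ≤ D) (hS1 : 1 ≤ S) (hT1 : 1 ≤ T₁)
    (hS : S ≤ 127.2 * u) (hT₁ : T₁ ≤ 2.195 * u) (hu : u ≤ 8.6 * D ^ 2) :
    log S + log T₁ ≤ 10 + 4 * log D := by
  have hu0 : 0 < u := by nlinarith
  have hST : S * T₁ ≤ 20650 * D ^ 4 := by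
    calc S * T₁ ≤ (127.2 * u) * (2.195 * u) := mul_le_mul hS hT₁ (by linarith) (by linarith)
      _ = 279.204 * u ^ 2 := by ring
      _ ≤ 279.204 * (8.6 * D ^ 2) ^ 2 := by gcongr
      _ ≤ 20650 * D ^ 4 := by nlinarith
  have h1 : log S + log T₁ = log (S * T₁) := (Real.log_mul (by linarith) (by linarith)).symm
  rw [h1]
  calc log (S * T₁) ≤ log (20650 * D ^ 4) := Real.log_le_log (by positivity) hST
    _ = log 20650 + 4 * log D := by
        rw [Real.log_mul (by norm_num) (by positivity), Real.log_pow]; norm_num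
    _ ≤ 10 + 4 * log D := by
        have := log_le_nat_of_le_pow (x := 20650) (by norm_num) 10 (by norm_num)
        norm_num at this
        linarith

/-- `log(1 + E S₁/H) ≤ 3.5 + log D` when `E ≤ 7.3891`, `S₁ ≤ 4.24 D H`. [folklore] -/
theorem log_one_add_le {E S₁ H D : ℝ} (hD : 1 ≤ D) (hE : E ≤ 7.3891) (hE0 : 0 ≤ E) (hH : 0 < H)
    (hS₁0 : 0 ≤ S₁) (hS₁ : S₁ ≤ 4.24 * D * H) :
    log (1 + E * S₁ / H) ≤ 3.5 + log D := by
  have h1 : E * S₁ / H ≤ 31.33 * D := by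
    rw [div_le_iff₀ hH]
    calc E * S₁ ≤ 7.3891 * (4.24 * D * H) := mul_le_mul hE hS₁ hS₁0 (by norm_num)
      _ ≤ 31.33 * D * H := by nlinarith
  have h2 : 1 + E * S₁ / H ≤ 32.33 * D := by linarith
  calc log (1 + E * S₁ / H) ≤ log (32.33 * D) := Real.log_le_log (by positivity) h2
    _ = log 32.33 + log D := by rw [Real.log_mul (by norm_num) (by positivity)]
    _ ≤ 3.5 + log D := by
        have := log_le_half_nat_of_sq_le_pow (x := 32.33) (by norm_num) 7 (by norm_num)
        norm_num at this
        linarith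

/-- `S₁ ≤ 4.24 D H` from `S₁ ≤ 6Dw + ½`, `H > 1.5w − 1`, `w ≥ 13.3`, `D ≥ 1`. [folklore] -/
theorem S₁_le_DH {S₁ H w D : ℝ} (hD : 1 ≤ D) (hw : 13.3 ≤ w) (hS₁ : S₁ ≤ 6 * D * w + 1 / 2)
    (hH : 1.5 * w - 1 < H) : S₁ ≤ 4.24 * D * H := by
  nlinarith [mul_le_mul_of_nonneg_left hw (by linarith : (0 : ℝ) ≤ D)]

/-! ### The terms of the main inequality (per row of the determinant) -/

/-- (M1) `log 2 + D log L ≤ 0.7 + 0.0067 Φ`, `Φ = D u v w`. [folklore] -/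
theorem term_M1 {D L u v w : ℝ} (hD : 1 ≤ D) (hL1 : 1 ≤ L) (hL : L ≤ 23 * D * (u * v * w))
    (huvw : 2124 * D ≤ u * v * w) :
    log 2 + D * log L ≤ 0.7 + 0.0067 * (D * u * v * w) := by
  have hD0 : 0 < D := by linarith
  have hP : 0 < u * v * w := by nlinarith
  have h1 : log L ≤ log D + log (23 * (u * v * w)) := by
    rw [← Real.log_mul hD0.ne' (by positivity)]
    exact Real.log_le_log (by linarith) (by nlinarith)
  have h2 : log D ≤ D - 1 := Real.log_le_sub_one_of_pos hD0
  have h3 : log (23 * (u * v * w)) ≤ 23 * (u * v * w) / 8095 + 8 := log_le_linear' (by positivity)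
  have h4 : D * log L ≤ D * (D - 1) + D * (23 * (u * v * w) / 8095 + 8) := by
    calc D * log L ≤ D * (log D + log (23 * (u * v * w))) := mul_le_mul_of_nonneg_left h1 hD0.le
      _ ≤ D * ((D - 1) + (23 * (u * v * w) / 8095 + 8)) := by gcongr
      _ = _ := by ring
  have h5 : D ^ 2 ≤ D * (u * v * w) / 2124 := by
    rw [le_div_iff₀ (by norm_num)]; nlinarith
  have hl2 := log_two_bounds.2
  have h6 : D ≤ D ^ 2 := by nlinarith
  have h7 : D * (23 * (u * v * w) / 8095 + 8) = 23 / 8095 * (D * u * v * w) + 8 * D := by ring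
  have h8 : D * (u * v * w) / 2124 = (D * u * v * w) / 2124 := by ring
  rw [h7] at h4
  rw [h8] at h5
  have hΦ0 : 0 ≤ D * u * v * w := by nlinarith
  nlinarith

/-- (M2a) `D S (1.15 H) ≤ 4.53 Φ` when `S ≤ 2.625uv`, `H ≤ 1.5 w`. [folklore] -/
theorem term_M2a {D S H u v w : ℝ} (hD : 0 ≤ D) (hS : S ≤ 2.625 * u * v) (hH0 : 0 ≤ H)
    (hH : H ≤ 1.5 * w) (hu : 0 ≤ u) (hv : 0 ≤ v) (hw : 0 ≤ w) :
    D * S * (23 / 20 * H) ≤ 4.53 * (D * u * v * w) := by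
  have h1 : S * H ≤ (2.625 * u * v) * (1.5 * w) := mul_le_mul hS hH hH0 (by positivity)
  have h2 := mul_le_mul_of_nonneg_left h1 hD
  have hΦ0 : 0 ≤ D * u * v * w := by positivity
  nlinarith

/-- (M2b) `D S (log T₁ + log S + hB) + S(log π + 2) ≤ 2.625 Φ`. [folklore] -/
theorem term_M2b {D S lS lT₁ hB u v w : ℝ} (hD : 1 ≤ D) (hS0 : 0 ≤ S) (hS : S ≤ 2.625 * u * v)
    (hlog : lS + lT₁ ≤ 10 + 4 * log D) (hw : w = hB + 4 * log D + 13.3) (hhB : 0 ≤ hB) :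
    D * S * (lT₁ + lS + hB) + S * (log Real.pi + 2) ≤ 2.625 * (D * u * v * w) := by
  have hπ := log_pi_le
  have h1 : lT₁ + lS + hB ≤ w - 3.3 := by rw [hw]; linarith
  have h2 : D * S * (lT₁ + lS + hB) ≤ D * S * (w - 3.3) := mul_le_mul_of_nonneg_left h1 (by positivity)
  have h3 : S * (log Real.pi + 2) ≤ 3.3 * (D * S) := by nlinarith
  have hw0 : 0 ≤ w := by rw [hw]; have := Real.log_nonneg hD; linarith
  have h4 : D * S * w ≤ D * (2.625 * u * v) * w :=
    mul_le_mul_of_nonneg_right (mul_le_mul_of_nonneg_left hS (by linarith)) hw0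
  nlinarith

/-- (M2c) `D H ≤ 0.00585 Φ` when `H ≤ 1.5w`, `uv ≥ 256.52`. [folklore] -/
theorem term_M2c {D H u v w : ℝ} (hD : 0 ≤ D) (hH : H ≤ 1.5 * w) (hw : 0 ≤ w) (hu : 5.3 ≤ u)
    (hv : 48.4 ≤ v) : D * H ≤ 0.00585 * (D * u * v * w) := by
  have h1 : 256.52 ≤ u * v := by nlinarith
  have h2 : D * H ≤ D * (1.5 * w) := mul_le_mul_of_nonneg_left hH hD
  have h3 : 1.5 * (D * w) ≤ 0.00585 * ((u * v) * (D * w)) := by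
    have : 0 ≤ D * w := mul_nonneg hD hw
    nlinarith
  nlinarith

/-- (M2d) `D T (1 + lb₂) ≤ 5.5 Φ` when `T ≤ 5Dvw`, `lb₂ ≤ 3.5 + log D`, `D(4.5 + log D) ≤ 1.1u`. [folklore] -/
theorem term_M2d {D T lb u v w : ℝ} (hD : 0 ≤ D) (hT : T ≤ 5 * D * v * w)
    (hlb0 : 0 ≤ lb) (hlb : lb ≤ 3.5 + log D) (hTg : D * (4.5 + log D) ≤ 11 / 10 * u) (hv : 0 ≤ v)
    (hw : 0 ≤ w) : D * T * (1 + lb) ≤ 5.5 * (D * u * v * w) := by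
  have h1 : D * T * (1 + lb) ≤ D * (5 * D * v * w) * (4.5 + log D) := by
    have ha : D * T ≤ D * (5 * D * v * w) := mul_le_mul_of_nonneg_left hT hD
    have hb : 1 + lb ≤ 4.5 + log D := by linarith
    exact mul_le_mul ha hb (by linarith) (by positivity)
  have h2 : D * (5 * D * v * w) * (4.5 + log D) = 5 * v * w * (D * (4.5 + log D)) * D := by ring
  rw [h2] at h1
  have h3 : 5 * v * w * (D * (4.5 + log D)) * D ≤ 5 * v * w * (11 / 10 * u) * D := by
    have : 0 ≤ 5 * v * w := by positivity
    exact mul_le_mul_of_nonneg_right (mul_le_mul_of_nonneg_left hTg this) hD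
  nlinarith

/-- (M2e) `π T₁ E S₁ ≤ 6.36 Φ` when `πE ≤ 23.22`, `T₁ ≤ 2.1u + ½`, `S₁ ≤ 6Dw + ½`. [folklore] -/
theorem term_M2e {D T₁ S₁ E u v w : ℝ} (hD : 1 ≤ D) (hπE : Real.pi * E ≤ 23.22)
    (hT₁0 : 0 ≤ T₁) (hT₁ : T₁ ≤ 2.1 * u + 1 / 2) (hS₁0 : 0 ≤ S₁) (hS₁ : S₁ ≤ 6 * D * w + 1 / 2)
    (hu : 5.3 ≤ u) (hv : 48.4 ≤ v) (hw : 13.3 ≤ w) :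
    Real.pi * T₁ * (E * S₁) ≤ 6.36 * (D * u * v * w) := by
  have hT₁' : T₁ ≤ 2.195 * u := by linarith
  have hS₁' : S₁ ≤ 6.038 * (D * w) := by nlinarith
  have h1 : Real.pi * T₁ * (E * S₁) = (Real.pi * E) * (T₁ * S₁) := by ring
  have h2 : T₁ * S₁ ≤ (2.195 * u) * (6.038 * (D * w)) := mul_le_mul hT₁' hS₁' hS₁0 (by linarith)
  have h3 : (Real.pi * E) * (T₁ * S₁) ≤ 23.22 * ((2.195 * u) * (6.038 * (D * w))) :=
    mul_le_mul hπE h2 (by positivity) (by norm_num)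
  rw [h1]
  have hDw : 0 ≤ D * w := by nlinarith
  nlinarith [mul_le_mul_of_nonneg_left hv (by positivity : (0:ℝ) ≤ u * (D * w))]

/-! ### The per-row main inequality -/

/-- **The per-row form of the main inequality**: with the parameter bounds of this file,
`X ≤ 0.7 + 19.03 Φ` where `X` is the left side of `NWPi.pi_core`'s `hmain` divided by `L`
(`E = e²`, `log E = 2`, `lν = 1.15 H`, `H_β = D h_B`). [cite: NesterenkoWaldschmidt1996, §6 d), (6.5)–(6.11)] -/
theorem perL_le {Dn : ℕ} (hDn : 1 ≤ Dn) {D S T T₁ S₁ H L u v w hB E : ℝ} (hDr : D = Dn)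
    (hu : u = 33 / 10 * D * log (D + 2) + 2) (hw : w = hB + 4 * log D + 13.3) (hhB : 0 ≤ hB)
    (hv1 : 48.4 ≤ v) (hv2 : v ≤ 48.44) (hE1 : E ≤ 7.3891) (hE1' : 1 ≤ E) (hπE : Real.pi * E ≤ 23.22)
    (hS1 : 1 ≤ S) (hS : S ≤ 2.625 * u * v) (hT0 : 0 ≤ T) (hT : T ≤ 5 * D * v * w)
    (hT₁1 : 1 ≤ T₁) (hT₁ : T₁ ≤ 2.1 * u + 1 / 2) (hS₁1 : 1 ≤ S₁) (hS₁ : S₁ ≤ 6 * D * w + 1 / 2)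
    (hHlo : 1.5 * w - 1 < H) (hH : H ≤ 1.5 * w) (hL1 : 1 ≤ L) (hL : L ≤ 23 * D * (u * v * w)) :
    log 2 + D * log L +
        (D - 1) * (S * (23 / 20 * H) + S * log T₁ + S * log S + (T + H) + T * log (1 + S₁ / H)) +
        S * (D * hB) + S * (23 / 20 * H) +
        (S * log S + (T + H) + T * log (1 + E * S₁ / H) + S * log (Real.pi * T₁) + Real.pi * T₁ * (E * S₁)) +
        S * 2 ≤
      0.7 + 19.03 * (D * u * v * w) := by
  have hD : (1 : ℝ) ≤ D := by rw [hDr]; exact_mod_cast hDn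
  have hD0 : (0 : ℝ) ≤ D := by linarith
  have hu' : u = 33 / 10 * (Dn : ℝ) * log ((Dn : ℝ) + 2) + 2 := by rw [hu, hDr]
  obtain ⟨hu53, hu33, hu86⟩ := u_bounds Dn hDn hu'
  rw [← hDr] at hu33 hu86
  have hu0 : 0 ≤ u := by linarith
  have hv0 : 0 ≤ v := by linarith
  have hw13 : 13.3 ≤ w := by rw [hw]; have := Real.log_nonneg hD; linarith
  have hw0 : 0 ≤ w := by linarith
  have hH0 : 0 < H := by linarith
  have hE0 : 0 ≤ E := by linarith
  have hS0 : 0 ≤ S := by linarith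
  have hT₁0 : 0 ≤ T₁ := by linarith
  have hS₁0 : 0 ≤ S₁ := by linarith
  -- the pieces
  have huvw : 2124 * D ≤ u * v * w := by
    calc 2124 * D ≤ (33 / 10 * D) * 48.4 * 13.3 := by nlinarith
      _ ≤ u * v * w := by
          have h1 : (33 / 10 * D) * 48.4 ≤ u * v := mul_le_mul hu33 hv1 (by norm_num) hu0
          exact mul_le_mul h1 hw13 (by norm_num) (by positivity)
  have hM1 := term_M1 hD hL1 hL huvw
  have hM2a := term_M2a hD0 hS hH0.le hH hu0 hv0 hw0
  have hlogST : log S + log T₁ ≤ 10 + 4 * log D :=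
    log_S_add_log_T₁_le hD hS1 hT₁1 (by nlinarith) (by linarith) hu86
  have hM2b := term_M2b (lS := log S) (lT₁ := log T₁) hD hS0 hS hlogST hw hhB
  have hM2c := term_M2c hD0 hH hw0 hu53 hv1
  have hS₁DH : S₁ ≤ 4.24 * D * H := S₁_le_DH hD hw13 hS₁ hHlo
  have hlb₂ : log (1 + E * S₁ / H) ≤ 3.5 + log D := log_one_add_le hD hE1 hE0 hH0 hS₁0 hS₁DH
  have hlb₂0 : 0 ≤ log (1 + E * S₁ / H) := Real.log_nonneg (by
    have : 0 ≤ E * S₁ / H := by positivity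
    linarith)
  have hTg : D * (4.5 + log D) ≤ 11 / 10 * u := by
    rw [hu, hDr]; exact Tgroup_ineq Dn hDn
  have hM2d := term_M2d hD0 hT hlb₂0 hlb₂ hTg hv0 hw0
  have hM2e := term_M2e hD hπE hT₁0 hT₁ hS₁0 hS₁ hu53 hv1 hw13
  -- `lb₁ ≤ lb₂`
  have hlb₁ : log (1 + S₁ / H) ≤ log (1 + E * S₁ / H) := by
    refine Real.log_le_log (by positivity) ?_
    have h1 : S₁ / H ≤ E * S₁ / H := by
      rw [div_le_div_iff_of_pos_right hH0]
      have := mul_le_mul_of_nonneg_right hE1' hS₁0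
      linarith
    linarith only [h1]
  have hlogπT₁ : log (Real.pi * T₁) = log Real.pi + log T₁ :=
    Real.log_mul Real.pi_pos.ne' (by linarith)
  rw [hlogπT₁]
  -- expand and compare
  have hD1 : 0 ≤ D - 1 := by linarith
  have e1 : (D - 1) * (T * log (1 + S₁ / H)) ≤ (D - 1) * (T * log (1 + E * S₁ / H)) :=
    mul_le_mul_of_nonneg_left (mul_le_mul_of_nonneg_left hlb₁ hT0) hD1
  have hΦ0 : 0 ≤ D * u * v * w := by positivity
  linarith only [e1, hM1, hM2a, hM2b, hM2c, hM2d, hM2e, hΦ0]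

/-! ### The parameters (floors) and the hypotheses of `NWPi.pi_core` -/

/-- `⌊x⌋₊ ≤ x < ⌊x⌋₊ + 1`. [folklore] -/
theorem floor_facts {x : ℝ} (hx : 0 ≤ x) : ((⌊x⌋₊ : ℕ) : ℝ) ≤ x ∧ x - 1 < ((⌊x⌋₊ : ℕ) : ℝ) :=
  ⟨Nat.floor_le hx, Nat.sub_one_lt_floor x⟩

/-- **The basic bounds on the parameters.** [cite: NesterenkoWaldschmidt1996, §6 (6.1), (6.4)] -/
theorem params_basic (Dn : ℕ) (hDn : 1 ≤ Dn) {hB u v w : ℝ} (hhB : 0 ≤ hB)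
    (hu : u = 33 / 10 * (Dn : ℝ) * log ((Dn : ℝ) + 2) + 2) (hv : v = 2 * exp 2 * Real.pi + 2)
    (hw : w = hB + 4 * log (Dn : ℝ) + 13.3) {T₁ S₁ H S T : ℕ}
    (hT₁ : T₁ = ⌊2.1 * u + 1 / 2⌋₊) (hS₁ : S₁ = ⌊6 * (Dn : ℝ) * w + 1 / 2⌋₊) (hH : H = ⌊1.5 * w⌋₊)
    (hS : S = ⌊2.625 * u * v⌋₊) (hT : T = ⌊5 * (Dn : ℝ) * v * w⌋₊) :
    (5.3 ≤ u ∧ 33 / 10 * (Dn : ℝ) ≤ u ∧ u ≤ 8.6 * (Dn : ℝ) ^ 2) ∧ (48.4 ≤ v ∧ v ≤ 48.44) ∧ 13.3 ≤ w ∧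
    ((T₁ : ℝ) ≤ 2.1 * u + 1 / 2 ∧ 2.1 * u + 1 / 2 - 1 < (T₁ : ℝ)) ∧
    ((S₁ : ℝ) ≤ 6 * (Dn : ℝ) * w + 1 / 2 ∧ 6 * (Dn : ℝ) * w + 1 / 2 - 1 < (S₁ : ℝ)) ∧
    ((H : ℝ) ≤ 1.5 * w ∧ 1.5 * w - 1 < (H : ℝ)) ∧
    ((S : ℝ) ≤ 2.625 * u * v ∧ 2.625 * u * v - 1 < (S : ℝ)) ∧
    ((T : ℝ) ≤ 5 * (Dn : ℝ) * v * w ∧ 5 * (Dn : ℝ) * v * w - 1 < (T : ℝ)) := by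
  have hD : (1 : ℝ) ≤ Dn := by exact_mod_cast hDn
  obtain ⟨hu53, hu33, hu86⟩ := u_bounds Dn hDn hu
  obtain ⟨hv1, hv2, -⟩ := v_bounds
  rw [← hv] at hv1 hv2
  have hw13 : 13.3 ≤ w := by rw [hw]; have := Real.log_nonneg hD; linarith
  have hu0 : 0 ≤ u := by linarith
  have hv0 : 0 ≤ v := by linarith
  have hw0 : 0 ≤ w := by linarith
  refine ⟨⟨hu53, hu33, hu86⟩, ⟨hv1, hv2⟩, hw13, ?_, ?_, ?_, ?_, ?_⟩
  · rw [hT₁]; exact floor_facts (by positivity)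
  · rw [hS₁]; exact floor_facts (by positivity)
  · rw [hH]; exact floor_facts (by positivity)
  · rw [hS]; exact floor_facts (by positivity)
  · rw [hT]; exact floor_facts (by positivity)

/-- **The counting conditions** (Lemma 6 / (2.1)) and the positivity of the parameters:
`H, T₁, S₁, S ≥ 1`, `2T₁ ≤ S + 1`, `(2T₁+1)T < (S+1-2T₁)(2S₁+1)`.
[cite: NesterenkoWaldschmidt1996, §6 a)] -/
theorem params_counts (Dn : ℕ) (hDn : 1 ≤ Dn) {hB u v w : ℝ} (hhB : 0 ≤ hB)
    (hu : u = 33 / 10 * (Dn : ℝ) * log ((Dn : ℝ) + 2) + 2) (hv : v = 2 * exp 2 * Real.pi + 2)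
    (hw : w = hB + 4 * log (Dn : ℝ) + 13.3) {T₁ S₁ H S T : ℕ}
    (hT₁ : T₁ = ⌊2.1 * u + 1 / 2⌋₊) (hS₁ : S₁ = ⌊6 * (Dn : ℝ) * w + 1 / 2⌋₊) (hH : H = ⌊1.5 * w⌋₊)
    (hS : S = ⌊2.625 * u * v⌋₊) (hT : T = ⌊5 * (Dn : ℝ) * v * w⌋₊) :
    (1 ≤ H ∧ 1 ≤ T₁ ∧ 1 ≤ S₁ ∧ 1 ≤ S) ∧ 2 * T₁ ≤ S + 1 ∧
      (2 * T₁ + 1) * T < (S + 1 - 2 * T₁) * (2 * S₁ + 1) := by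
  have hD : (1 : ℝ) ≤ Dn := by exact_mod_cast hDn
  obtain ⟨⟨hu53, -, -⟩, ⟨hv1, -⟩, hw13, ⟨hT₁le, hT₁gt⟩, ⟨-, hS₁gt⟩, ⟨-, hHgt⟩,
    ⟨-, hSgt⟩, ⟨hTle, -⟩⟩ := params_basic Dn hDn hhB hu hv hw hT₁ hS₁ hH hS hT
  have hu0 : 0 ≤ u := by linarith only [hu53]
  have hw0 : 0 ≤ w := by linarith only [hw13]
  have hD0 : (0 : ℝ) ≤ Dn := by linarith only [hD]
  have hDw : 1 * 13.3 ≤ (Dn : ℝ) * w := mul_le_mul hD hw13 (by norm_num) hD0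
  have huv : 5.3 * 48.4 ≤ u * v := mul_le_mul hu53 hv1 (by norm_num) hu0
  have huv' : 2.625 * u * 48.4 ≤ 2.625 * u * v := mul_le_mul_of_nonneg_left hv1 (by linarith only [hu0])
  have h1 : 1 ≤ H := by
    have : (1 : ℝ) ≤ H := by linarith only [hHgt, hw13]
    exact_mod_cast this
  have h2 : 1 ≤ T₁ := by
    have : (1 : ℝ) ≤ T₁ := by linarith only [hT₁gt, hu53]
    exact_mod_cast this
  have h3 : 1 ≤ S₁ := by
    have : (1 : ℝ) ≤ S₁ := by linarith only [hS₁gt, hDw]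
    exact_mod_cast this
  have h4 : 1 ≤ S := by
    have : (1 : ℝ) ≤ S := by linarith only [hSgt, huv]
    exact_mod_cast this
  have h5r : (2 : ℝ) * T₁ < S + 1 := by linarith only [hT₁le, hSgt, huv', hu53]
  have h5 : 2 * T₁ ≤ S + 1 := by
    have : ((2 * T₁ : ℕ) : ℝ) < ((S + 1 : ℕ) : ℝ) := by push_cast; exact h5r
    exact (Nat.cast_lt.mp this).le
  refine ⟨⟨h1, h2, h3, h4⟩, h5, ?_⟩
  -- the count, in `ℝ`; `Φ = D u v w`
  have hDvw0 : (0 : ℝ) ≤ (Dn : ℝ) * v * w := by positivity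
  have hDuw0 : (0 : ℝ) ≤ (Dn : ℝ) * u * w := by positivity
  have hA : 48.4 * ((Dn : ℝ) * u * w) ≤ (Dn : ℝ) * u * v * w := by
    have := mul_le_mul_of_nonneg_left hv1 hDuw0; linarith only [this]
  have hB : 256.52 * ((Dn : ℝ) * w) ≤ (Dn : ℝ) * u * v * w := by
    have := mul_le_mul_of_nonneg_left huv (by linarith only [hDw] : (0 : ℝ) ≤ (Dn : ℝ) * w)
    linarith only [this]
  have hC : 5.3 * ((Dn : ℝ) * v * w) ≤ (Dn : ℝ) * u * v * w := by
    have := mul_le_mul_of_nonneg_left hu53 hDvw0; linarith only [this]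
  have hlhs : ((2 * T₁ + 1 : ℕ) : ℝ) * T ≤ 21 * ((Dn : ℝ) * u * v * w) + 10 * ((Dn : ℝ) * v * w) := by
    push_cast
    have ha : (2 : ℝ) * T₁ + 1 ≤ 4.2 * u + 2 := by linarith only [hT₁le]
    have hb : (0 : ℝ) ≤ T := Nat.cast_nonneg _
    have hc : ((2 : ℝ) * T₁ + 1) * T ≤ (4.2 * u + 2) * (5 * Dn * v * w) :=
      mul_le_mul ha hTle hb (by positivity)
    have e : (4.2 * u + 2) * (5 * (Dn : ℝ) * v * w) = 21 * ((Dn : ℝ) * u * v * w) + 10 * ((Dn : ℝ) * v * w) := by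
      ring
    linarith only [hc, e]
  have hrhs : 30 * ((Dn : ℝ) * u * v * w) ≤ ((S + 1 - 2 * T₁ : ℕ) : ℝ) * ((2 * S₁ + 1 : ℕ) : ℝ) := by
    rw [Nat.cast_sub h5]
    push_cast
    have ha : 2.625 * u * v - 4.2 * u - 1 ≤ (S : ℝ) + 1 - 2 * T₁ := by linarith only [hSgt, hT₁le]
    have ha0 : 0 ≤ 2.625 * u * v - 4.2 * u - 1 := by linarith only [huv', hu53]
    have hb : 12 * (Dn : ℝ) * w ≤ 2 * S₁ + 1 := by linarith only [hS₁gt]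
    have hc : (2.625 * u * v - 4.2 * u - 1) * (12 * Dn * w) ≤ ((S : ℝ) + 1 - 2 * T₁) * (2 * S₁ + 1) :=
      mul_le_mul ha hb (by positivity) (by linarith only [ha0, ha])
    have e : (2.625 * u * v - 4.2 * u - 1) * (12 * (Dn : ℝ) * w) =
        31.5 * ((Dn : ℝ) * u * v * w) - 50.4 * ((Dn : ℝ) * u * w) - 12 * ((Dn : ℝ) * w) := by ring
    have hΦ0 : (0 : ℝ) ≤ (Dn : ℝ) * u * v * w := by positivity
    linarith only [hc, e, hA, hB, hΦ0]
  have hmid : 21 * ((Dn : ℝ) * u * v * w) + 10 * ((Dn : ℝ) * v * w) < 30 * ((Dn : ℝ) * u * v * w) := by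
    have hpos : (0 : ℝ) < (Dn : ℝ) * v * w := by
      have : (0 : ℝ) < v := by linarith only [hv1]
      have : (0 : ℝ) < w := by linarith only [hw13]
      positivity
    linarith only [hC, hpos]
  have : (((2 * T₁ + 1) * T : ℕ) : ℝ) < (((S + 1 - 2 * T₁) * (2 * S₁ + 1) : ℕ) : ℝ) := by
    rw [Nat.cast_mul, Nat.cast_mul]
    exact lt_of_le_of_lt hlhs (hmid.trans_le hrhs)
  exact_mod_cast this

/-- **The size of `L = (T+1)(2T₁+1)`**: `21 Φ < L ≤ 23 Φ` (`Φ = D u v w ≥ 3411`), and the smallness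
exponent `log S + S log(4.2) + 2L ≤ 47 Φ`. [cite: NesterenkoWaldschmidt1996, §6 (6.4)] -/
theorem params_L (Dn : ℕ) (hDn : 1 ≤ Dn) {hB u v w : ℝ} (hhB : 0 ≤ hB)
    (hu : u = 33 / 10 * (Dn : ℝ) * log ((Dn : ℝ) + 2) + 2) (hv : v = 2 * exp 2 * Real.pi + 2)
    (hw : w = hB + 4 * log (Dn : ℝ) + 13.3) {T₁ S₁ H S T L : ℕ}
    (hT₁ : T₁ = ⌊2.1 * u + 1 / 2⌋₊) (hS₁ : S₁ = ⌊6 * (Dn : ℝ) * w + 1 / 2⌋₊) (hH : H = ⌊1.5 * w⌋₊)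
    (hS : S = ⌊2.625 * u * v⌋₊) (hT : T = ⌊5 * (Dn : ℝ) * v * w⌋₊) (hL : L = (T + 1) * (2 * T₁ + 1)) :
    3411 ≤ (Dn : ℝ) * u * v * w ∧ 21 * ((Dn : ℝ) * u * v * w) < L ∧ (L : ℝ) ≤ 23 * Dn * (u * v * w) ∧
      Real.log S + S * Real.log (21 / 5) + 2 * L ≤ 47 * ((Dn : ℝ) * u * v * w) := by
  have hD : (1 : ℝ) ≤ Dn := by exact_mod_cast hDn
  obtain ⟨⟨hu53, -, -⟩, ⟨hv1, -⟩, hw13, ⟨hT₁le, hT₁gt⟩, ⟨-, -⟩, ⟨-, -⟩,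
    ⟨hSle, hSgt⟩, ⟨hTle, hTgt⟩⟩ := params_basic Dn hDn hhB hu hv hw hT₁ hS₁ hH hS hT
  have hLr : (L : ℝ) = ((T : ℝ) + 1) * (2 * T₁ + 1) := by rw [hL]; push_cast; ring
  have hu0 : 0 < u := by linarith only [hu53]
  have hv0 : 0 < v := by linarith only [hv1]
  have hw0 : 0 < w := by linarith only [hw13]
  have hD0 : (0 : ℝ) ≤ Dn := by linarith only [hD]
  have hDvw : 1 * 48.4 * 13.3 ≤ (Dn : ℝ) * v * w := by
    have h1 : 1 * 48.4 ≤ (Dn : ℝ) * v := mul_le_mul hD hv1 (by norm_num) hD0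
    exact mul_le_mul h1 hw13 (by norm_num) (by positivity)
  have hΦu : 5.3 * ((Dn : ℝ) * v * w) ≤ (Dn : ℝ) * u * v * w := by
    have := mul_le_mul_of_nonneg_right hu53 (by positivity : (0 : ℝ) ≤ (Dn : ℝ) * v * w)
    linarith only [this]
  have hΦDvw : 643.72 * u ≤ (Dn : ℝ) * u * v * w := by
    have := mul_le_mul_of_nonneg_left hDvw hu0.le
    linarith only [this]
  have hΦ : 3411 ≤ (Dn : ℝ) * u * v * w := by nlinarith only [hΦDvw, hu53]
  have hlow : 21 * ((Dn : ℝ) * u * v * w) < L := by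
    rw [hLr]
    have ha : 5 * (Dn : ℝ) * v * w < (T : ℝ) + 1 := by linarith only [hTgt]
    have hb : 4.2 * u < 2 * (T₁ : ℝ) + 1 := by linarith only [hT₁gt]
    have hc : (5 * (Dn : ℝ) * v * w) * (4.2 * u) < ((T : ℝ) + 1) * (2 * T₁ + 1) :=
      mul_lt_mul'' ha hb (by positivity) (by positivity)
    have e : (5 * (Dn : ℝ) * v * w) * (4.2 * u) = 21 * ((Dn : ℝ) * u * v * w) := by ring
    linarith only [hc, e]
  have hhigh : (L : ℝ) ≤ 23 * Dn * (u * v * w) := by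
    rw [hLr]
    have ha : (T : ℝ) + 1 ≤ 5 * Dn * v * w + 1 := by linarith only [hTle]
    have hb : 2 * (T₁ : ℝ) + 1 ≤ 4.2 * u + 2 := by linarith only [hT₁le]
    have hc : ((T : ℝ) + 1) * (2 * T₁ + 1) ≤ (5 * Dn * v * w + 1) * (4.2 * u + 2) :=
      mul_le_mul ha hb (by positivity) (by positivity)
    have e : (5 * (Dn : ℝ) * v * w + 1) * (4.2 * u + 2) =
        21 * ((Dn : ℝ) * u * v * w) + 10 * ((Dn : ℝ) * v * w) + 4.2 * u + 2 := by ring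
    have e' : 23 * (Dn : ℝ) * (u * v * w) = 23 * ((Dn : ℝ) * u * v * w) := by ring
    linarith only [hc, e, e', hΦu, hΦDvw, hΦ]
  refine ⟨hΦ, hlow, hhigh, ?_⟩
  have huv : 5.3 * 48.4 ≤ u * v := mul_le_mul hu53 hv1 (by norm_num) hu0.le
  have hS1 : (1 : ℝ) ≤ S := by linarith only [hSgt, huv]
  have hS0 : (0 : ℝ) ≤ S := by linarith only [hS1]
  have hlogS : Real.log S ≤ (S : ℝ) := by
    have := Real.log_le_sub_one_of_pos (by linarith only [hS1] : (0 : ℝ) < S)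
    linarith only [this]
  have hlogR : Real.log (21 / 5 : ℝ) ≤ 1.5 := by
    have := log_le_half_nat_of_sq_le_pow (x := 21 / 5) (by norm_num) 3 (by norm_num)
    norm_num at this ⊢
    linarith only [this]
  have hSlogR : (S : ℝ) * Real.log (21 / 5) ≤ 1.5 * S := by
    have := mul_le_mul_of_nonneg_left hlogR hS0; linarith only [this]
  have hDw : 1 * 13.3 ≤ (Dn : ℝ) * w := mul_le_mul hD hw13 (by norm_num) hD0
  have hE : 13.3 * (u * v) ≤ (Dn : ℝ) * u * v * w := by
    have := mul_le_mul_of_nonneg_left hDw (by positivity : (0 : ℝ) ≤ u * v)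
    linarith only [this]
  have e' : 23 * (Dn : ℝ) * (u * v * w) = 23 * ((Dn : ℝ) * u * v * w) := by ring
  linarith only [hlogS, hSlogR, hSle, hE, hhigh, e', hΦ]

/-- **The main inequality** (hypothesis `hmain` of `NWPi.pi_core` with `E = e²`, `lν = 1.15 H`,
`H_β = D h_B`, `Dr = D`): the analogue of "`84.83 DUVW log E < ½ L log E`" (p. 6) for the
parameters of this file (here: `0.7 + 19.03 Φ < 21 Φ − 1 < L − 1` per row).
[cite: NesterenkoWaldschmidt1996, §6 d), (6.4)–(6.11)] -/
theorem params_main (Dn : ℕ) (hDn : 1 ≤ Dn) {hB u v w : ℝ} (hhB : 0 ≤ hB)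
    (hu : u = 33 / 10 * (Dn : ℝ) * log ((Dn : ℝ) + 2) + 2) (hv : v = 2 * exp 2 * Real.pi + 2)
    (hw : w = hB + 4 * log (Dn : ℝ) + 13.3) {T₁ S₁ H S T L : ℕ}
    (hT₁ : T₁ = ⌊2.1 * u + 1 / 2⌋₊) (hS₁ : S₁ = ⌊6 * (Dn : ℝ) * w + 1 / 2⌋₊) (hH : H = ⌊1.5 * w⌋₊)
    (hS : S = ⌊2.625 * u * v⌋₊) (hT : T = ⌊5 * (Dn : ℝ) * v * w⌋₊) (hL : L = (T + 1) * (2 * T₁ + 1)) :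
    (L : ℝ) * Real.log 2 + (Dn : ℝ) * L * Real.log L +
        ((Dn : ℝ) - 1) * L * (S * (23 / 20 * (H : ℝ)) + S * Real.log T₁ + S * Real.log S +
          ((T : ℝ) + H) + T * Real.log (1 + (S₁ : ℝ) / H)) +
        L * S * ((Dn : ℝ) * hB) + L * S * (23 / 20 * (H : ℝ)) +
        L * (S * Real.log S + ((T : ℝ) + H) + T * Real.log (1 + Real.exp 2 * S₁ / H) +
          S * Real.log (Real.pi * T₁) + Real.pi * T₁ * (Real.exp 2 * S₁)) +
        L * S * Real.log (Real.exp 2) <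
      (L : ℝ) * ((L : ℝ) - 1) / 2 * Real.log (Real.exp 2) := by
  have hD : (1 : ℝ) ≤ Dn := by exact_mod_cast hDn
  obtain ⟨⟨hu53, -, -⟩, ⟨hv1, hv2⟩, hw13, ⟨hT₁le, hT₁gt⟩, ⟨hS₁le, hS₁gt⟩, ⟨hHle, hHgt⟩,
    ⟨hSle, hSgt⟩, ⟨hTle, hTgt⟩⟩ := params_basic Dn hDn hhB hu hv hw hT₁ hS₁ hH hS hT
  obtain ⟨hΦ, hlow, hhigh, -⟩ := params_L Dn hDn hhB hu hv hw hT₁ hS₁ hH hS hT hL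
  obtain ⟨-, -, hπE⟩ := v_bounds
  obtain ⟨hE1, hE2⟩ := exp_two_bounds
  have hu0 : 0 ≤ u := by linarith only [hu53]
  have hD0 : (0 : ℝ) ≤ Dn := by linarith only [hD]
  have huv : 5.3 * 48.4 ≤ u * v := mul_le_mul hu53 hv1 (by norm_num) hu0
  have hDw : 1 * 13.3 ≤ (Dn : ℝ) * w := mul_le_mul hD hw13 (by norm_num) hD0
  have hS1 : (1 : ℝ) ≤ S := by linarith only [hSgt, huv]
  have hT0 : (0 : ℝ) ≤ T := Nat.cast_nonneg _
  have hT₁1 : (1 : ℝ) ≤ T₁ := by linarith only [hT₁gt, hu53]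
  have hS₁1 : (1 : ℝ) ≤ S₁ := by linarith only [hS₁gt, hDw]
  have hL1 : (1 : ℝ) ≤ L := by linarith only [hlow, hΦ]
  have hu' : u = 33 / 10 * (Dn : ℝ) * log ((Dn : ℝ) + 2) + 2 := hu
  have hX := perL_le (Dn := Dn) hDn (D := Dn) rfl hu' hw hhB hv1 hv2 hE2.le
    (by linarith only [hE1]) (by linarith only [hπE]) hS1 hSle hT0 hTle hT₁1 hT₁le hS₁1 hS₁le
    hHgt hHle hL1 hhigh
  rw [Real.log_exp]
  have hLpos : (0 : ℝ) < L := by linarith only [hL1]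
  -- per row: `X < L - 1`
  have hXlt : Real.log 2 + (Dn : ℝ) * Real.log L +
      ((Dn : ℝ) - 1) * (S * (23 / 20 * (H : ℝ)) + S * Real.log T₁ + S * Real.log S + ((T : ℝ) + H) +
        T * Real.log (1 + (S₁ : ℝ) / H)) +
      S * ((Dn : ℝ) * hB) + S * (23 / 20 * (H : ℝ)) +
      (S * Real.log S + ((T : ℝ) + H) + T * Real.log (1 + Real.exp 2 * S₁ / H) +
        S * Real.log (Real.pi * T₁) + Real.pi * T₁ * (Real.exp 2 * S₁)) +
      S * 2 < (L : ℝ) - 1 := by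
    linarith only [hX, hlow, hΦ]
  have hmul := mul_lt_mul_of_pos_left hXlt hLpos
  have e1 : (L : ℝ) * ((L : ℝ) - 1) / 2 * 2 = L * ((L : ℝ) - 1) := by ring
  rw [e1]
  refine lt_of_eq_of_lt ?_ hmul
  ring

end NWPi

end Literature.NumberTheory.Transcendental

end
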